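import Summits.QuantumFields.YangMills.Theorems.IR.ShellMaxCorrDoubling
import Literature.MathematicalPhysics.QuantumLattice.LatticeGaugeDLRCovarianceSplit

/-!
# Crux `IR` (item stmt-QuantumFields-19354) — line «maximal correlation at one physical thickness»:
SUPPORTS of local observables on the torus and elementary bounds

Helper module for item `stmt-QuantumFields-19354` (`--supports … --as helper`; it closes nothing; lead prover
ym-ir-line-mxc-p1).  Third input of the registered stub `ShellMaxCorr.stub_shellEngine : ShellEngine`
(`Theorems/IR/ShellMaxCorrDefs.lean`).

* §6 support bookkeeping in the vocabulary `siteNorm` / `InBall` / `OutBall` of the Defs file: a local gauge-invariant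
  observable `A` read through the periodic lift `torusLift N` depends only on the links of the fixed sup-ball `B_{r_A}`
  (`exists_radius_dependsOn_inBall`, every torus), and `B` translated by `n ≤ S` lattice units in Euclidean time
  (`configShift (−n e₀)`) read through `torusLift (2S+1)` depends only on links outside the open sup-ball of radius
  `n − r_B` (`exists_radius_dependsOn_outBall`); the arithmetic core is `sub_natAbs_le_natAbs_valMinAbs`: on `ℤ/(2S+1)`,
  for `n ≤ S`, the class of `x₀ + n` is at cyclic distance `≥ n − |x₀|` from `0` (no wrap-around below half the period).
* §7 elementary bounds under a probability measure: `|∫ f| ≤ C`, `σ(f) ≤ C` (Popoviciu, Mathlib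
  `variance_le_sq_of_bounded`), `|∫ f g − ∫ f ∫ g| ≤ 2 C_f C_g`.

HONEST FRAMING: bookkeeping toward ONE stub of a CONDITIONAL rung line; no mass-gap claim.
-/

set_option autoImplicit false

noncomputable section

open Filter Topology MeasureTheory ProbabilityTheory
open Literature.MathematicalPhysics.QuantumFieldTheory Literature.MathematicalPhysics.QuantumLattice
open Literature.Probability.LatticeModels (Torus.proj)
open Summit.QuantumFields.YangMills.Cruxes.OSLegsFromFemtoAndGap.DlrCollarTransfer (GapInUnits LowerBounds)

namespace Summit.QuantumFields.YangMills.Cruxes.IR.ShellMaxCorr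

/-! ## §6 Supports of local observables on the torus: inner ball and shifted outer region -/

section Supports

variable {G : Type} [Group G]

/-- The sup-norm of the projection of an integer site is at most the max of its integer coordinates. -/
theorem siteNorm_proj_le {N : ℕ} [NeZero N] (x : Literature.Probability.LatticeModels.Site 4) (M : ℕ)
    (hM : ∀ k, (x k).natAbs ≤ M) : siteNorm (Torus.proj N x) ≤ M := by
  unfold siteNorm
  refine Finset.sup_le fun k _ => ?_
  exact (Literature.MathematicalPhysics.QuantumLattice.natAbs_valMinAbs_intCast_le (L := N) (x k)).trans (hM k)

/-- A coordinate bounds the sup-norm from below. -/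
theorem natAbs_valMinAbs_apply_le_siteNorm {N : ℕ} (y : Site 4 N) (k : Fin 4) :
    ((y k).valMinAbs).natAbs ≤ siteNorm y :=
  Finset.le_sup (f := fun k => ((y k).valMinAbs).natAbs) (Finset.mem_univ k)

/-- **Cyclic-distance arithmetic of the time translation.**  On `ℤ/(2S+1)`, for `n ≤ S` the class of `x₀ + n` is at
cyclic distance `≥ n − |x₀|` from `0`. -/
theorem sub_natAbs_le_natAbs_valMinAbs (S n : ℕ) (hn : n ≤ S) (x₀ : ℤ) :
    n - x₀.natAbs ≤ (((x₀ + n : ℤ) : ZMod (2 * S + 1))).valMinAbs.natAbs := by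
  set z : ℤ := x₀ + n with hz
  set v : ℤ := (((z : ℤ) : ZMod (2 * S + 1))).valMinAbs with hv
  have hvS : v.natAbs ≤ S := by
    have := ZMod.natAbs_valMinAbs_le (n := 2 * S + 1) ((z : ℤ) : ZMod (2 * S + 1))
    rw [← hv] at this
    omega
  have hcast : ((v : ℤ) : ZMod (2 * S + 1)) = ((z : ℤ) : ZMod (2 * S + 1)) := by
    rw [hv, ZMod.coe_valMinAbs]
  rw [ZMod.intCast_eq_intCast_iff_dvd_sub] at hcast
  obtain ⟨j, hj⟩ := hcast
  have hzle : z.natAbs ≤ x₀.natAbs + n := by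
    rw [hz]; simpa using Int.natAbs_add_le x₀ (n : ℤ)
  have hnle : n ≤ z.natAbs + x₀.natAbs := by
    have h := Int.natAbs_sub_le z x₀
    rw [hz, add_sub_cancel_left, Int.natAbs_natCast] at h
    rwa [← hz] at h
  rcases eq_or_ne j 0 with hj0 | hj0
  · rw [hj0, mul_zero, sub_eq_zero] at hj
    -- `z = v`
    rw [hj] at hnle
    omega
  · have hjabs : 1 ≤ j.natAbs := Int.natAbs_pos.2 hj0
    have hdiff : (z - v).natAbs = (2 * S + 1) * j.natAbs := by
      rw [hj, Int.natAbs_mul, Int.natAbs_natCast]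
    have hge : 2 * S + 1 ≤ (z - v).natAbs := by
      rw [hdiff]; nlinarith
    have hle : (z - v).natAbs ≤ z.natAbs + v.natAbs := Int.natAbs_sub_le z v
    omega

variable [MeasurableSpace G]

/-- **Inner support.**  A local observable read through the periodic lift depends only on the links of a fixed sup-ball
about the origin, on EVERY torus. -/
theorem exists_radius_dependsOn_inBall (A : LocalGaugeObservable 4 G) :
    ∃ rA : ℕ, ∀ (N : ℕ) [NeZero N],
      DependsOn (fun U : GaugeConfig 4 N G => A.F (torusLift N U)) {e | InBall rA e} := by
  classical
  set M : ℕ := A.supp.sup fun e => Finset.univ.sup fun k => (e.1 k).natAbs with hM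
  refine ⟨M + 1, fun N _ => ?_⟩
  intro U V hUV
  apply A.isCylinder
  intro e he
  refine hUV (torusEdge N e) ?_
  simp only [torusEdge, Set.mem_setOf_eq]
  have hx : siteNorm (Torus.proj N e.1) ≤ M := by
    refine siteNorm_proj_le e.1 M fun k => ?_
    exact (Finset.le_sup (f := fun k => (e.1 k).natAbs) (Finset.mem_univ k)).trans
      (Finset.le_sup (f := fun e : Literature.MathematicalPhysics.QuantumLattice.ZdEdge 4 => Finset.univ.sup fun k => (e.1 k).natAbs) he)
  exact ⟨hx.trans (Nat.le_succ M), (siteNorm_shift_le _ _).trans (Nat.succ_le_succ hx)⟩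

/-- **Outer support of the time-translated observable.**  On the torus of side `2S+1`, the observable `B` translated by
`n ≤ S` lattice units in Euclidean time and read through the periodic lift depends only on links outside the open
sup-ball of radius `n − r_B`. -/
theorem exists_radius_dependsOn_outBall (B : LocalGaugeObservable 4 G) :
    ∃ rB : ℕ, ∀ (S n : ℕ), n ≤ S →
      DependsOn (fun U : GaugeConfig 4 (2 * S + 1) G =>
        B.F (configShift (-Pi.single 0 (n : ℤ)) (torusLift (2 * S + 1) U))) {e | OutBall (n - rB) e} := by
  classical
  set M : ℕ := B.supp.sup fun e => Finset.univ.sup fun k => (e.1 k).natAbs with hM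
  refine ⟨M + 1, fun S n hn => ?_⟩
  intro U V hUV
  apply B.isCylinder
  intro e he
  rw [configShift_apply, configShift_apply]
  refine hUV (torusEdge (2 * S + 1) (e.1 - -Pi.single 0 (n : ℤ), e.2)) ?_
  simp only [torusEdge, Set.mem_setOf_eq, sub_neg_eq_add]
  have hx0 : (e.1 0).natAbs ≤ M :=
    (Finset.le_sup (f := fun k => (e.1 k).natAbs) (Finset.mem_univ (0 : Fin 4))).trans
      (Finset.le_sup (f := fun e : Literature.MathematicalPhysics.QuantumLattice.ZdEdge 4 => Finset.univ.sup fun k => (e.1 k).natAbs) he)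
  set y : Site 4 (2 * S + 1) := Torus.proj (2 * S + 1) (e.1 + Pi.single 0 (n : ℤ)) with hy
  have hbase : n - M ≤ siteNorm y := by
    refine le_trans ?_ (natAbs_valMinAbs_apply_le_siteNorm y 0)
    have h := sub_natAbs_le_natAbs_valMinAbs S n hn (e.1 0)
    have hy0 : y 0 = (((e.1 0 + n : ℤ) : ℤ) : ZMod (2 * S + 1)) := by
      simp only [hy, Torus.proj, Pi.add_apply, Pi.single_eq_same]
    rw [hy0]
    exact le_trans (Nat.sub_le_sub_left hx0 n) h
  have htip : n - (M + 1) ≤ siteNorm (y.shift e.2) := by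
    have := siteNorm_le_shift y e.2
    omega
  exact ⟨le_trans (Nat.sub_le_sub_left (Nat.le_succ M) n) hbase, htip⟩

end Supports


/-! ## §7 Elementary bounds for bounded observables under a probability measure -/

section Bounds

variable {G : Type} [MeasurableSpace G] {N : ℕ}

/-- `|∫ f| ≤ C` if `|f| ≤ C` pointwise, under a probability measure. -/
theorem abs_integral_le_of_abs_le (μ : Measure (GaugeConfig 4 N G)) [IsProbabilityMeasure μ]
    {f : GaugeConfig 4 N G → ℝ} {C : ℝ} (hC : ∀ U, |f U| ≤ C) : |∫ U, f U ∂μ| ≤ C := by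
  have := norm_integral_le_of_norm_le_const (μ := μ) (f := f) (C := C)
    (ae_of_all _ fun U => by rw [Real.norm_eq_abs]; exact hC U)
  simpa only [probReal_univ, mul_one, Real.norm_eq_abs] using this

/-- The standard deviation of an observable bounded by `C` is at most `C` (Popoviciu). -/
theorem sqrt_variance_le (μ : Measure (GaugeConfig 4 N G)) [IsProbabilityMeasure μ]
    {f : GaugeConfig 4 N G → ℝ} (hf : Measurable f) {C : ℝ} (hC : ∀ U, |f U| ≤ C) (hC0 : 0 ≤ C) :
    Real.sqrt (Var[f; μ]) ≤ C := by
  have hvar : Var[f; μ] ≤ C ^ 2 := by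
    have h := variance_le_sq_of_bounded (μ := μ) (a := -C) (b := C) (X := f)
      (ae_of_all _ fun U => ⟨(abs_le.1 (hC U)).1, (abs_le.1 (hC U)).2⟩) hf.aemeasurable
    have hCC : ((C - -C) / 2) ^ 2 = C ^ 2 := by ring
    rwa [hCC] at h
  calc Real.sqrt (Var[f; μ]) ≤ Real.sqrt (C ^ 2) := Real.sqrt_le_sqrt hvar
    _ = C := Real.sqrt_sq hC0

/-- Trivial bound `|∫ f g − ∫ f ∫ g| ≤ 2 C_f C_g`. -/
theorem abs_corr_le_two_mul (μ : Measure (GaugeConfig 4 N G)) [IsProbabilityMeasure μ]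
    {f g : GaugeConfig 4 N G → ℝ} {Cf Cg : ℝ} (hCf : ∀ U, |f U| ≤ Cf) (hCg : ∀ U, |g U| ≤ Cg) (hCf0 : 0 ≤ Cf) :
    |(∫ U, f U * g U ∂μ) - (∫ U, f U ∂μ) * (∫ U, g U ∂μ)| ≤ 2 * Cf * Cg := by
  have h1 : |∫ U, f U * g U ∂μ| ≤ Cf * Cg :=
    abs_integral_le_of_abs_le μ fun U => by
      rw [abs_mul]; exact mul_le_mul (hCf U) (hCg U) (abs_nonneg _) ((abs_nonneg _).trans (hCf U))
  have h2 : |(∫ U, f U ∂μ) * (∫ U, g U ∂μ)| ≤ Cf * Cg := by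
    rw [abs_mul]
    exact mul_le_mul (abs_integral_le_of_abs_le μ hCf) (abs_integral_le_of_abs_le μ hCg) (abs_nonneg _) hCf0
  calc |(∫ U, f U * g U ∂μ) - (∫ U, f U ∂μ) * (∫ U, g U ∂μ)|
      ≤ |∫ U, f U * g U ∂μ| + |(∫ U, f U ∂μ) * (∫ U, g U ∂μ)| := abs_sub _ _
    _ ≤ Cf * Cg + Cf * Cg := add_le_add h1 h2
    _ = 2 * Cf * Cg := by ring

end Bounds

end Summit.QuantumFields.YangMills.Cruxes.IR.ShellMaxCorr

end
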